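import Literature.NumberTheory.Automorphic.AdelicAdditiveCharacterDuality
import Literature.NumberTheory.Automorphic.WhittakerBesselGL2
import Literature.NumberTheory.Automorphic.AutomorphicSpectrumProofs
import HarnessLib

/-!
# The archimedean unipotent line and torus of `GL_2` in the adelic group: character values,
# the character form `B(ξ, x) = -2π Tr(ξ x)`, and the right-regular operators `U_x = R(n(x))`

Topic `NumberTheory/Automorphic`; namespace `Literature.NumberTheory.Automorphic`. Groundwork for the
`L²`-bound of global Whittaker coefficients along the archimedean torus of `GL_2` (the Kirillov
integral at `s = 1` of the Rankin–Selberg method, Jacquet–Langlands (1970), §2; Jacquet–Shalika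
(1981), §3–§4). Everything is phrased in the tree's `GL_2` vocabulary (`WhittakerBesselGL2`):
`unipotentGL2 x = n(x) = (1 x; 0 1)`, `diagGL2 a b = diag(a, b)`, the dilation relation
`diagGL2_mul_unipotentGL2_mul_inv`, and the infinite adele `infiniteAdeleInl K` (`AdelicGLnGlue`); the
archimedean elements are

  `n((x, 0)) = unipotentGL2 (mixedInfiniteAdele x)`, `x ∈ K_∞ = mixedSpace K`
  (`mixedInfiniteAdele x = infiniteAdeleInl K ((ringEquiv_mixedSpace K).symm x)`, an `abbrev`; this is
  `archUnipotent 2 1 K (· ↦ x)` by `archUnipotent_two_one_eq`), and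
  `(a(y), 1) = GLn.ofInfinite 2 K (diagGL2 y 1)`, `y ∈ K_∞ˣ`.

We PROVE:

* `ofInfinite_unipotentGL2` — `GLn.ofInfinite 2 K (n(x)) = n((x, 0))` (bridge between the two
  spellings), hence `archDilation_inv_mul_archUnipotent_mul` — the adelic **dilation relation**
  `(a(y),1)⁻¹ n((x,0)) (a(y),1) = n((y⁻¹x, 0))` (from `diagGL2_mul_unipotentGL2_mul_inv`);
* `archCharForm` (definition: `B = -2π · tracePairing K`), `archCharForm_nondegenerate`,
  `archCharForm_mul_left` — the non-degenerate real bilinear form on `K_∞` with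
  **`ψ_K((x, 0)) = exp(i B(1, x)) = exp(-2πi Tr_{K_∞/ℝ} x)`** for Tate's character
  (`coe_adeleAddChar_mixedInfiniteAdele`, `coe_adeleAddChar_mixedInfiniteAdele_mul`); with
  `whittakerCharFun_unipotentGL2` this is the value of the generic character on `n((x, 0))`;
* `rightRegular_archUnipotent_add`, `norm_rightRegular_archUnipotent`,
  `continuous_rightRegular_archUnipotent` — the operators `U_x = R(n((x,0)))` of the right regular
  representation on `L²(GL_2(K) A_G \ GL_2(𝔸_K))` form a strongly continuous unitary representation of
  `(K_∞, +)`, and `inner_rightRegular_archDilation_conj` — **covariance of matrix coefficients**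
  `⟪R(a(y)) f, U_x R(a(y)) f⟫ = ⟪f, U_{y⁻¹x} f⟫`, with `B(y⁻¹ ξ, x) = B(ξ, y⁻¹ x)`
  (`archCharForm_inv_smul_left`): the hypotheses of the spectral-measure dictionary
  `Literature.Analysis.UnboundedOperators.UnitaryRepSpectralMeasure`.

## References

* H. Jacquet, R. P. Langlands, *Automorphic forms on GL(2)*, LNM 114 (1970), §2 [JacquetLanglands1970].
* H. Jacquet, J. A. Shalika, *On Euler products and the classification of automorphic
  representations I*, Amer. J. Math. 103 (1981), §3–§4 [JacquetShalikaAJM1981].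
* J. W. S. Cassels, A. Fröhlich (eds.), *Algebraic Number Theory* (1967), Ch. XV (Tate), §2.2
  [CasselsFrohlichANT1967].
-/

noncomputable section

open scoped MatrixGroups InnerProductSpace Real
open NumberField NumberField.mixedEmbedding IsDedekindDomain MeasureTheory Matrix Complex

namespace Literature.NumberTheory.Automorphic

section Adelic

variable {K : Type} [Field K] [NumberField K]

variable (K) in
/-- The infinite adele `(x, 0)` of `x ∈ K_∞ = mixedSpace K` (the spelling used by
`archUnipotent_two_one_eq`). [folklore] -/
abbrev mixedInfiniteAdele (x : mixedSpace K) : AdeleRing (𝓞 K) K :=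
  infiniteAdeleInl K ((InfiniteAdeleRing.ringEquiv_mixedSpace K).symm x)

/-- `(x, 0)` unfolded. [folklore] -/
theorem mixedInfiniteAdele_apply (x : mixedSpace K) :
    mixedInfiniteAdele K x = ((InfiniteAdeleRing.ringEquiv_mixedSpace K).symm x, 0) := rfl

/-- `x ↦ (x, 0)` is additive. [folklore] -/
theorem mixedInfiniteAdele_add (x x' : mixedSpace K) :
    mixedInfiniteAdele K (x + x') = mixedInfiniteAdele K x + mixedInfiniteAdele K x' := by
  rw [mixedInfiniteAdele, map_add, map_add]

/-- `x ↦ (x, 0)` is multiplicative. [folklore] -/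
theorem mixedInfiniteAdele_mul (x x' : mixedSpace K) :
    mixedInfiniteAdele K (x * x') = mixedInfiniteAdele K x * mixedInfiniteAdele K x' := by
  rw [mixedInfiniteAdele, map_mul, map_mul]

/-- `x ↦ (x, 0)` is continuous. [folklore] -/
theorem continuous_mixedInfiniteAdele : Continuous (mixedInfiniteAdele K) := by
  refine (Continuous.prodMk ?_ continuous_const : Continuous fun x : mixedSpace K =>
    (((InfiniteAdeleRing.ringEquiv_mixedSpace K).symm x, (0 : FiniteAdeleRing (𝓞 K) K)) : AdeleRing (𝓞 K) K))
  exact continuous_ringEquiv_mixedSpace_symm K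

/-- The infinite adele `(x, 0)` is finite-integral. [folklore] -/
theorem isFiniteIntegral_mixedInfiniteAdele (x : mixedSpace K) : IsFiniteIntegral K (mixedInfiniteAdele K x) :=
  fun v => by
    change (0 : FiniteAdeleRing (𝓞 K) K) v ∈ _
    exact zero_mem _

variable (K) in
/-- `n((x, 0)) ∈ GL_2(𝔸_K)`, typed in the adelic group of the `GL_2` datum (so that `rightRegular`
applies). [folklore] -/
@[reducible] def archUnipotentAdelic (x : mixedSpace K) : (AdelicGroupData.gl 2 K).Adelic :=
  ((unipotentGL2 (mixedInfiniteAdele K x) : ↥(adelicUnipotent 2 K)) : GL (Fin 2) (AdeleRing (𝓞 K) K))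

variable (K) in
/-- `(a(y), 1) = (diag(y, 1), 1) ∈ GL_2(𝔸_K)`, typed in the adelic group of the `GL_2` datum. [folklore] -/
@[reducible] def archDilationAdelic (y : (mixedSpace K)ˣ) : (AdelicGroupData.gl 2 K).Adelic :=
  GLn.ofInfinite 2 K (diagGL2 y 1)

/-- `x ↦ n((x, 0))` is a homomorphism from `(K_∞, +)`. [folklore] -/
theorem archUnipotentAdelic_add (x x' : mixedSpace K) :
    archUnipotentAdelic K (x + x') = archUnipotentAdelic K x * archUnipotentAdelic K x' := by
  show (((unipotentGL2 (mixedInfiniteAdele K (x + x')) : ↥(adelicUnipotent 2 K)) :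
      GL (Fin 2) (AdeleRing (𝓞 K) K))) =
    ((unipotentGL2 (mixedInfiniteAdele K x) : ↥(adelicUnipotent 2 K)) : GL (Fin 2) (AdeleRing (𝓞 K) K)) *
      ((unipotentGL2 (mixedInfiniteAdele K x') : ↥(adelicUnipotent 2 K)) : GL (Fin 2) (AdeleRing (𝓞 K) K))
  rw [mixedInfiniteAdele_add, unipotentGL2_add, Subgroup.coe_mul]

/-- `n((0, 0)) = 1`. [folklore] -/
theorem archUnipotentAdelic_zero : archUnipotentAdelic K 0 = 1 := by
  show (((unipotentGL2 (mixedInfiniteAdele K 0) : ↥(adelicUnipotent 2 K)) : GL (Fin 2) (AdeleRing (𝓞 K) K))) = 1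
  rw [mixedInfiniteAdele, map_zero, map_zero, unipotentGL2_zero, Subgroup.coe_one]

/-- `x ↦ n((x, 0))` is continuous. [folklore] -/
theorem continuous_archUnipotentAdelic : Continuous (archUnipotentAdelic K) :=
  continuous_subtype_val.comp (continuous_unipotentGL2.comp continuous_mixedInfiniteAdele)

/-- **Bridge between the two spellings**: `GLn.ofInfinite 2 K (n(x)) = n((x, 0))` for `x ∈ K_∞`.
[folklore] -/
theorem ofInfinite_unipotentGL2 (x : mixedSpace K) :
    GLn.ofInfinite 2 K ((unipotentGL2 x : ↥(upperUnitriangular (Fin 2) (mixedSpace K))) :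
      GL (Fin 2) (mixedSpace K)) = archUnipotentAdelic K x := by
  refine Units.ext (Matrix.ext fun i j => ?_)
  rw [GLn.coe_ofInfinite_apply, coe_unipotentGL2]
  change _ = (((unipotentGL2 (mixedInfiniteAdele K x) : ↥(adelicUnipotent 2 K)) :
    GL (Fin 2) (AdeleRing (𝓞 K) K)) : Matrix (Fin 2) (Fin 2) (AdeleRing (𝓞 K) K)) i j
  rw [coe_unipotentGL2]
  fin_cases i <;> fin_cases j
  · change ((InfiniteAdeleRing.ringEquiv_mixedSpace K).symm 1, (1 : FiniteAdeleRing (𝓞 K) K)) = (1 : AdeleRing (𝓞 K) K)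
    rw [map_one]; rfl
  · rfl
  · change ((InfiniteAdeleRing.ringEquiv_mixedSpace K).symm 0, (0 : FiniteAdeleRing (𝓞 K) K)) = (0 : AdeleRing (𝓞 K) K)
    rw [map_zero]; rfl
  · change ((InfiniteAdeleRing.ringEquiv_mixedSpace K).symm 1, (1 : FiniteAdeleRing (𝓞 K) K)) = (1 : AdeleRing (𝓞 K) K)
    rw [map_one]; rfl

/-- **The adelic dilation relation**: `(a(y),1)⁻¹ n((x,0)) (a(y),1) = n((y⁻¹ x, 0))`
(`diagGL2_mul_unipotentGL2_mul_inv` at `K_∞`, pushed through `GLn.ofInfinite`). [folklore] -/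
theorem archDilation_inv_mul_archUnipotent_mul (y : (mixedSpace K)ˣ) (x : mixedSpace K) :
    (archDilationAdelic K y)⁻¹ * archUnipotentAdelic K x * archDilationAdelic K y =
      archUnipotentAdelic K (((y⁻¹ : (mixedSpace K)ˣ) : mixedSpace K) * x) := by
  have hdiag : (diagGL2 y 1 : GL (Fin 2) (mixedSpace K))⁻¹ = diagGL2 y⁻¹ 1 := by
    rw [inv_eq_iff_mul_eq_one, ← show diagGL2 (y * y⁻¹) ((1 : (mixedSpace K)ˣ) * 1) =
      diagGL2 y 1 * diagGL2 y⁻¹ 1 from diagGL2_mul y 1 y⁻¹ 1, mul_inv_cancel, mul_one, diagGL2_one]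
  have h := diagGL2_mul_unipotentGL2_mul_inv (y⁻¹) x
  rw [← hdiag, inv_inv] at h
  have h' : (GLn.ofInfinite 2 K (diagGL2 y 1))⁻¹ *
      GLn.ofInfinite 2 K ((unipotentGL2 x : ↥(upperUnitriangular (Fin 2) (mixedSpace K))) :
        GL (Fin 2) (mixedSpace K)) * GLn.ofInfinite 2 K (diagGL2 y 1) =
      GLn.ofInfinite 2 K ((unipotentGL2 (((y⁻¹ : (mixedSpace K)ˣ) : mixedSpace K) * x) :
        ↥(upperUnitriangular (Fin 2) (mixedSpace K))) : GL (Fin 2) (mixedSpace K)) := by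
    rw [← map_inv, ← map_mul, ← map_mul, h]
  rw [← ofInfinite_unipotentGL2, ← ofInfinite_unipotentGL2]
  exact h'

variable (K) in
/-- **The character form** `B(ξ, x) = -2π · Tr_{K_∞/ℝ}(ξ x)` on `K_∞`: the real bilinear form for
which Tate's archimedean character is `ψ_∞(ξ x) = exp(i B(ξ, x))`; a scalar multiple of the trace
pairing (`tracePairing`). [cite: CasselsFrohlichANT1967, Ch. XV (Tate), §2.2] -/
def archCharForm : LinearMap.BilinForm ℝ (mixedSpace K) := (-(2 * π)) • tracePairing K

/-- Unfolding of `archCharForm`. [folklore] -/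
theorem archCharForm_apply (ξ x : mixedSpace K) : archCharForm K ξ x = -(2 * π) * mixedTrace K (ξ * x) := by
  change (-(2 * π)) * tracePairing K ξ x = _
  rw [tracePairing_apply]

/-- **The character form is non-degenerate** (the trace form of the étale `ℝ`-algebra `K_∞` is).
[folklore] -/
theorem archCharForm_nondegenerate : (archCharForm K).Nondegenerate := by
  have hc : (-(2 * π) : ℝ) ≠ 0 := by
    have : (0 : ℝ) < 2 * π := by positivity
    linarith
  have hnd := tracePairing_nondegenerate K
  refine ⟨fun ξ h => hnd.1 ξ fun x => ?_, fun x h => hnd.2 x fun ξ => ?_⟩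
  · have := h x
    rw [archCharForm_apply, ← tracePairing_apply] at this
    exact (mul_eq_zero.1 this).resolve_left hc
  · have := h ξ
    rw [archCharForm_apply, ← tracePairing_apply] at this
    exact (mul_eq_zero.1 this).resolve_left hc

/-- `B(y ξ, x) = B(ξ, y x)` (`K_∞` is commutative). [folklore] -/
theorem archCharForm_mul_left (y ξ x : mixedSpace K) : archCharForm K (y * ξ) x = archCharForm K ξ (y * x) := by
  rw [archCharForm_apply, archCharForm_apply]
  congr 2
  ring

/-- The `B`-adjoint of `x ↦ y⁻¹ x` is `ξ ↦ y⁻¹ ξ`. [folklore] -/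
theorem archCharForm_inv_smul_left (y : (mixedSpace K)ˣ) (ξ x : mixedSpace K) :
    archCharForm K (((y⁻¹ : (mixedSpace K)ˣ) : mixedSpace K) * ξ) x =
      archCharForm K ξ (((y⁻¹ : (mixedSpace K)ˣ) : mixedSpace K) * x) :=
  archCharForm_mul_left _ ξ x

/-- **Tate's archimedean character in closed form**: for `x ∈ K_∞`,
`ψ_K((x, 0)) = exp(-2πi Tr_{K_∞/ℝ}(x)) = exp(i B(1, x))`. [cite: CasselsFrohlichANT1967, Ch. XV (Tate), §2.2] -/
theorem coe_adeleAddChar_mixedInfiniteAdele (x : mixedSpace K) :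
    (adeleAddChar K (mixedInfiniteAdele K x) : ℂ) = cexp ((archCharForm K 1 x : ℝ) * I) := by
  rw [adeleAddChar_apply_of_isFiniteIntegral K (isFiniteIntegral_mixedInfiniteAdele x)]
  change (AddCircle.toCircle (-(((infiniteAdeleTrace K
    ((InfiniteAdeleRing.ringEquiv_mixedSpace K).symm x)) : ℝ) : AddCircle (1 : ℝ))) : ℂ) = _
  rw [← mixedTrace_ringEquiv_mixedSpace, RingEquiv.apply_symm_apply, ← AddCircle.coe_neg,
    AddCircle.toCircle_apply_mk, Circle.coe_exp, archCharForm_apply, one_mul]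
  congr 1
  push_cast
  ring

/-- The general character `ξ ↦ ψ_K((ξ x, 0)) = exp(i B(ξ, x))`. [folklore] -/
theorem coe_adeleAddChar_mixedInfiniteAdele_mul (ξ x : mixedSpace K) :
    (adeleAddChar K (mixedInfiniteAdele K (ξ * x)) : ℂ) = cexp ((archCharForm K ξ x : ℝ) * I) := by
  rw [coe_adeleAddChar_mixedInfiniteAdele, ← archCharForm_mul_left, mul_one]

/-- **The generic character on `n((x, 0))` for Tate's character** is `exp(i B(1, x))`
(`whittakerCharFun_unipotentGL2`). [folklore] -/
theorem coe_whittakerCharFun_adeleAddChar_unipotentGL2 (x : mixedSpace K) :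
    (whittakerCharFun (adeleAddChar K) (unipotentGL2 (mixedInfiniteAdele K x)) : ℂ) =
      cexp ((archCharForm K 1 x : ℝ) * I) := by
  rw [whittakerCharFun_unipotentGL2, coe_adeleAddChar_mixedInfiniteAdele]

end Adelic

/-! ### The right-regular operators `U_x = R(n((x,0)))` and `R((a(y),1))` -/

section Regular

variable {K : Type} [Field K] [NumberField K]
  (μ : Measure (AdelicGroupData.gl 2 K).automorphicQuotient) [(AdelicGroupData.gl 2 K).IsAutomorphicMeasure μ]

/-- **`x ↦ U_x = R(n((x, 0)))` is a homomorphism** into the operators of `L²`: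
`U_{x + x'} = U_x ∘ U_{x'}`. [folklore] -/
theorem rightRegular_archUnipotent_add (x x' : mixedSpace K) :
    (AdelicGroupData.gl 2 K).rightRegular μ (archUnipotentAdelic K (x + x')) =
      ((AdelicGroupData.gl 2 K).rightRegular μ (archUnipotentAdelic K x)).comp
        ((AdelicGroupData.gl 2 K).rightRegular μ (archUnipotentAdelic K x')) := by
  rw [archUnipotentAdelic_add, map_mul, ContinuousLinearMap.mul_def]

/-- **Each `U_x` is an isometry of `L²`.** [folklore] -/
theorem norm_rightRegular_archUnipotent (x : mixedSpace K) (f : (AdelicGroupData.gl 2 K).L2 μ) :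
    ‖(AdelicGroupData.gl 2 K).rightRegular μ (archUnipotentAdelic K x) f‖ = ‖f‖ :=
  (AdelicGroupData.gl 2 K).norm_rightRegular_apply μ _ f

/-- **Strong continuity of `x ↦ U_x f`.** [folklore] -/
theorem continuous_rightRegular_archUnipotent (f : (AdelicGroupData.gl 2 K).L2 μ) :
    Continuous fun x : mixedSpace K => (AdelicGroupData.gl 2 K).rightRegular μ (archUnipotentAdelic K x) f :=
  ((AdelicGroupData.isStronglyContinuous_rightRegular_holds (AdelicGroupData.gl 2 K) μ) f).comp
    continuous_archUnipotentAdelic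

/-- **Covariance of matrix coefficients under dilation**: for `D = R((a(y), 1))`,
`⟪D f, U_x (D f)⟫ = ⟪f, U_{y⁻¹ x} f⟫` (unitarity of `D` and `D⁻¹ U_x D = U_{y⁻¹ x}`).
[cite: JacquetShalikaAJM1981, §4] -/
theorem inner_rightRegular_archDilation_conj (y : (mixedSpace K)ˣ) (x : mixedSpace K)
    (f : (AdelicGroupData.gl 2 K).L2 μ) :
    ⟪(AdelicGroupData.gl 2 K).rightRegular μ (archDilationAdelic K y) f,
      (AdelicGroupData.gl 2 K).rightRegular μ (archUnipotentAdelic K x)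
        ((AdelicGroupData.gl 2 K).rightRegular μ (archDilationAdelic K y) f)⟫_ℂ =
      ⟪f, (AdelicGroupData.gl 2 K).rightRegular μ
        (archUnipotentAdelic K (((y⁻¹ : (mixedSpace K)ˣ) : mixedSpace K) * x)) f⟫_ℂ := by
  set R := (AdelicGroupData.gl 2 K).rightRegular μ with hR
  have hu := (AdelicGroupData.gl 2 K).isUnitary_rightRegular μ
  have h1 : R ((archDilationAdelic K y)⁻¹ * archUnipotentAdelic K x * archDilationAdelic K y) f =
      R (archDilationAdelic K y)⁻¹ (R (archUnipotentAdelic K x) (R (archDilationAdelic K y) f)) := by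
    rw [map_mul, map_mul]; rfl
  have h2 : R (archDilationAdelic K y)⁻¹ (R (archDilationAdelic K y) f) = f := by
    rw [show R (archDilationAdelic K y)⁻¹ (R (archDilationAdelic K y) f) =
      (R (archDilationAdelic K y)⁻¹ * R (archDilationAdelic K y)) f from rfl, ← map_mul, inv_mul_cancel, map_one]
    rfl
  rw [← archDilation_inv_mul_archUnipotent_mul, h1,
    ← hu.inner_map_map (archDilationAdelic K y)⁻¹ (R (archDilationAdelic K y) f), h2]

end Regular

end Literature.NumberTheory.Automorphic
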